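import Summits.ResolutionOfSingularities.ResolutionOfSingularities.Theorems.WeightedInvariantIota3TauDescentBaseTwoTransfer
import Summits.ResolutionOfSingularities.ResolutionOfSingularities.Theorems.AQSHeightTwoLexMaxGerm
import HarnessLib

/-!
# (desc-τ), CASE A′ OVER A BASE ESSENTIALLY OF FINITE TYPE OVER A FIELD: the base datum exists, has order `ν ≥ 2`, and the tie plays its move
# (door `HypersurfaceCentreConstruction`, stmt-ResolutionOfSingularities-19897; registered stub `stub_keyRungGrHomLE_three`, gap (1) (desc-τ))

Topic: `Summits/ResolutionOfSingularities/ResolutionOfSingularities/Theorems`. Helper for the door item `HypersurfaceCentreConstruction`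
(stmt-ResolutionOfSingularities-19897, route `WeightedInvariant`), line `local-engine`, def-free.  Fourth brick of the flat-pullback argument for case
(A′) of (desc-τ) (…Iota3TauDescentLowDim, …BaseTwo, …BaseTwoLexMax, …BaseTwoTransfer):

* `Iota3.not_isMonomialType_of_isTiePosition_map` — if `(T', φ g)` is a tie position then `g` is NOT of monomial type (monomial type ascends,
  `EssSmoothDescent.isMonomialType_map`, and is never a tie, `not_isTiePosition_of_isMonomialType`); `Iota3.two_le_of_isTiePosition_map` — hence
  `ν ≥ 2` for the order `ν` of `g` when `dim T = 2` (an element of order `≤ 1` of a two-dimensional regular local ring is a unit or a regular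
  parameter).
* **`Iota3.exists_base_datum_of_isTiePresentation`** — `T` regular local of dimension two, ESSENTIALLY OF FINITE TYPE OVER A FIELD `k₀` (the door
  setting; this is where Abramovich–Quek–Schober existence `AQSHeightTwo.exists_isLexMaxWeightedCentreGerm` is available), `φ : T → T'` local formally
  smooth essentially of finite type into a regular `T'` of dimension three, `(x, y, z; q, r; λ)` a tie presentation of `(T', φ g)` with plane
  `(x, y) = 𝔪_T T'`.  Then there are `t, s ∈ T` with `(t, s; r, q; rν)` THE lex-maximal admissible weighted centre germ of `(g) ⊆ T` — SAME weights
  `(r, q)` as the tie, `ν = ord g ≥ 2` — and the tie's weighted filtration is the extension of the base's: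
  `𝒥ₙ((y, x); (r, q)) = 𝒥ₙ((t, s); (r, q))·T'` for all `n`.

So over the door's bases the cylinder move of a case-(A′) tie IS the base change along `φ` of the Abramovich–Quek–Schober point move of the plane
curve germ `(T, g)`, whose successors over `𝔪_T` all DROP the order (`LexMaxOrderDrop.adicOrder_transform_lt_of_isLexMax`, `ν ≥ 2`); the one
missing brick of (A′) is the flat base change of the extended Rees algebra (`extReesAlgebra 𝒥 ⊗_T T' ≅ extReesAlgebra (𝒥·T')`, Mathlib
`AddMonoidAlgebra.scalarTensorEquiv` + flatness) making the no-drop successor of …TieNoDropSuccessor contract to a successor of `B_T` with the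
same order (`IotaOrderEssSmooth.mem_maximalIdeal_pow_iff_of_formallySmooth` at the localised map).

[OURS · L1 W4.3 · (desc-τ) case A′, brick 4]  Replaces the role of NO printed item; NOT a statement of the manuscript under review
[claim: Hironaka2017, status: under-review]; candidates stay candidates; AI work, weaker than expert review.  No definition; no axiom.

## References

* D. Abramovich, M. H. Quek, B. Schober, arXiv:2507.01232 (2025), Thm 1.3 (1), Thm 3.5. [AbramovichQuekSchober2025]
* H. Matsumura, *Commutative Ring Theory* (1986), Thm. 14.2, §22 Cor. to Thm. 22.5. [Matsumura1987]
-/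

noncomputable section

set_option linter.dupNamespace false -- mandated namespace `Summit.<Summit>.<Problem>` of this single-conjunct summit

open IsLocalRing Literature.AlgebraicGeometry.Resolution
open Summit.ResolutionOfSingularities.ResolutionOfSingularities.Theorems
open Summit.ResolutionOfSingularities.ResolutionOfSingularities.Theorems.ContactCylinder

namespace Summit.ResolutionOfSingularities.ResolutionOfSingularities.Cruxes.HypersurfaceCentreConstruction.LocalEngine

namespace Iota3

section Datum

variable (T T' : Type) [CommRing T] [CommRing T'] [IsRegularLocalRing T] [IsRegularLocalRing T'] [Algebra T T']
  [IsLocalHom (algebraMap T T')] [Algebra.FormallySmooth T T'] [Algebra.EssFiniteType T T']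

/-- **At a tie upstairs the equation downstairs is not of monomial type** (monomial type ascends and is never a tie). [OURS] -/
theorem not_isMonomialType_of_isTiePosition_map {g : T} (ht : IsTiePosition T' (algebraMap T T' g)) : ¬ IsMonomialType g :=
  fun hm => not_isTiePosition_of_isMonomialType (EssSmoothDescent.isMonomialType_map hm) ht

/-- **`ν ≥ 2` at a tie upstairs**: `g` lies in `𝔪_T` (the map is local) and is not a regular parameter (monomial type is never a tie), so its
order `ν` is at least two. [OURS] -/
theorem two_le_of_isTiePosition_map {g : T} (ht : IsTiePosition T' (algebraMap T T' g)) {ν : ℕ}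
    (hgν : g ∈ maximalIdeal T ^ ν) (hgν1 : g ∉ maximalIdeal T ^ (ν + 1)) : 2 ≤ ν := by
  have hg𝔪 : g ∈ maximalIdeal T := by
    refine (IsLocalRing.mem_maximalIdeal g).mpr (mem_nonunits_iff.mpr fun hu => ?_)
    exact (IsLocalRing.mem_maximalIdeal _).mp ht.mem_maximalIdeal (hu.map (algebraMap T T'))
  have hnm := not_isMonomialType_of_isTiePosition_map T T' ht
  by_contra hlt
  have hν : ν = 0 ∨ ν = 1 := by omega
  rcases hν with rfl | rfl
  · exact hgν1 (by rw [zero_add, pow_one]; exact hg𝔪)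
  · rw [pow_one] at hgν
    exact hnm ⟨1, g, 1, isUnit_one, hgν, hgν1, by rw [one_mul, pow_one]⟩

/-- `(f) = (yⁿ)` in a domain makes `f` of monomial type when `y` is a regular parameter. [folklore] -/
theorem isMonomialType_of_span_eq_span_pow {f y : T} (hy : y ∈ maximalIdeal T) (hy2 : y ∉ maximalIdeal T ^ 2) {n : ℕ}
    (h : Ideal.span {f} = Ideal.span {y ^ n}) : IsMonomialType f := by
  haveI := isDomain_of_isRegularLocalRing T
  obtain ⟨u, hu⟩ := Ideal.span_singleton_eq_span_singleton.mp h
  refine ⟨(u⁻¹ : Tˣ), y, n, Units.isUnit _, hy, hy2, ?_⟩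
  rw [← hu, mul_comm f, ← mul_assoc, Units.inv_mul, one_mul]

/-- **THE BASE DATUM OF A CASE-(A′) TIE PRESENTATION** (see the module docstring): over a two-dimensional base essentially of finite type over a
field, a tie presentation with plane `𝔪_T T'` has the weights `(r, q)` and the extended filtration of THE lex-maximal Abramovich–Quek–Schober
datum `(t, s; r, q; rν)` of `(g) ⊆ T`, with `ν = ord g ≥ 2`. [cite: AbramovichQuekSchober2025, Thm 1.3 (1), Thm 3.5] -/
theorem exists_base_datum_of_isTiePresentation (k₀ : Type) [Field k₀] [Algebra k₀ T] [Algebra.EssFiniteType k₀ T]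
    (hdimT : ringKrullDim T = (2 : ℕ)) (hdimT' : ringKrullDim T' = (3 : ℕ))
    {g : T} (ht : IsTiePosition T' (algebraMap T T' g))
    {x y z : T'} {q r : ℕ} {lam : T'} (h : IsTiePresentation T' (algebraMap T T' g) x y z q r lam)
    (hxy : Ideal.span {x, y} = (maximalIdeal T).map (algebraMap T T'))
    {ν : ℕ} (hfν : algebraMap T T' g ∈ maximalIdeal T' ^ ν) (hfν1 : algebraMap T T' g ∉ maximalIdeal T' ^ (ν + 1)) :
    2 ≤ ν ∧ g ∈ maximalIdeal T ^ ν ∧ g ∉ maximalIdeal T ^ (ν + 1) ∧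
      ∃ t s : T, Ideal.span {s, t} = maximalIdeal T ∧ 0 < q ∧ q ≤ r ∧
        IsLexMaxWeightedCentreGerm T (Ideal.span {g}) ![t, s] ![r, q] (r * ν) ∧
        ∀ n, weightedMonomialIdeal ![y, x] ![r, q] n = (weightedMonomialIdeal ![t, s] ![r, q] n).map (algebraMap T T') := by
  obtain ⟨hgν, hgν1⟩ := mem_pow_and_not_mem_of_map T T' hfν hfν1
  have h2 := two_le_of_isTiePosition_map T T' ht hgν hgν1
  have hg0 : g ≠ 0 := fun h0 => ht.ne_zero (by rw [h0, map_zero])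
  have hnm := not_isMonomialType_of_isTiePosition_map T T' ht
  have hny : ∀ y' : T, y' ∈ maximalIdeal T → y' ∉ maximalIdeal T ^ 2 → ∀ n : ℕ, Ideal.span {g} ≠ Ideal.span {y' ^ n} :=
    fun y' hy' hy'2 n heq => hnm (isMonomialType_of_span_eq_span_pow T hy' hy'2 heq)
  have hdim2 : ringKrullDim T = 2 := by rw [hdimT]; rfl
  obtain ⟨s, t, q', r', ν', -, hgν', hgν'1, hq', hq'r', hst, hlex⟩ :=
    AQSHeightTwo.exists_isLexMaxWeightedCentreGerm T k₀ hdim2 g hg0 hny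
  -- `ν' = ν`
  obtain rfl : ν = ν' := by
    by_contra hne
    rcases Nat.lt_or_gt_of_ne hne with hlt | hgt
    · exact hgν1 (Ideal.pow_le_pow_right (by omega) hgν')
    · exact hgν'1 (Ideal.pow_le_pow_right (by omega) hgν)
  -- the tie carries the base's weights and filtration
  obtain ⟨hw, -, hfil⟩ := IsTiePresentation.weights_eq_of_base T T' hdimT hdimT' h hxy hlex hfν hfν1
  have hr : r' = r := by have := congr_fun hw 0; simpa using this
  have hq : q' = q := by have := congr_fun hw 1; simpa using this
  subst hr hq
  exact ⟨h2, hgν, hgν1, t, s, hst, hq', hq'r', hlex, hfil⟩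

end Datum

end Iota3

end Summit.ResolutionOfSingularities.ResolutionOfSingularities.Cruxes.HypersurfaceCentreConstruction.LocalEngine

end
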